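import Summits.AtomisticToContinuum.HydrodynamicLimit.Theorems.OneFlightGossipEngineEquilibriumClampedCollisionalWindowLDAdaptedClampKinematics

/-!
# Stub `stub_adaptedClampKinematics` (S2) of line `coarse-coin-entropy-chain`, crux `EquilibriumClampedCollisionalWindowLD`

Pathwise record combinatorics for the clamped collisional transfers of the hard-sphere flow on `𝕋³`
(stmt-AtomisticToContinuum-13733, repair C′ = `ClampedTransferWindowLD`; vocabulary
`OneFlightGossipEngineEquilibriumClampedCollisionalWindowLDDefs`, helper lemmas
`OneFlightGossipEngineEquilibriumClampedCollisionalWindowLDAdaptedClampKinematics`):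

* (a) swap of the window-global for the adapted activity clamp: `|X - X̃| ≤ w L V · overflowCount` on good orbits —
  the two clamped transfers differ only at records both of whose adapted flags are up while a participant `i`
  overflows in the window; charged to `i`, the records with `fst = i` have `|payload| ≤ L ε_N · impulse` and retained
  impulses summing to `≤ (τ/σ) V` (running clamp), and the records with `snd = i` are the twins of those;
* (b) every coin mark is bounded: `|T_n| ≤ w L V` (two ordered records, each `≤ w L V / 2`);
* (c) every coin mark is dominated by its truncated predictable range: `|T_n| ≤ L ρ_n` (termwise).

`L` is a Lipschitz constant of `φ` for the minimal-image separation vector. No regularity of the torus geometry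
(`ε_N < 1/2`) is needed.
-/

noncomputable section

open MeasureTheory ProbabilityTheory Set Filter
open scoped ENNReal BigOperators
open Literature.Analysis.FluidPDE Literature.MathematicalPhysics.KineticTheory
open Literature.Analysis.FunctionSpaces (Torus.partialDeriv Torus.IsSmooth)

namespace Summit.AtomisticToContinuum.HydrodynamicLimit.Theorems.ClampedTransferCoin

namespace AdaptedClampKinematics

open HardSphereCollisionRecord

section Orbit

variable {σ τ V : ℝ} {N : ℕ} (Φ : Flow σ N) {z : Phase N}

/-- A record retained by the adapted clamp of its first particle has `|payload| ≤ L w V`. -/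
theorem abs_payload_le_window (φ : T3 → ℝ) {L : ℝ} (hL : 0 ≤ L)
    (hLip : ∀ x y : T3, |φ x - φ y| ≤ L * ‖(Torus.geometry (Fin 3)).sepVec x y‖)
    (hz : z ∈ Φ.good) (hσ : 0 < σ) (hτ : 0 < τ) {t : ℝ} (ht : 0 < t) {p : Fin (N + 1) × Fin (N + 1)}
    (hp : p ∈ contactPairs (Torus.geometry (Fin 3)) (hsDiameter σ N) (Φ.flow t z)) (hA : flagA σ τ V Φ t p.1 z = 1)
    (r : Option (Fin 3)) :
    |payload φ r (ofConfig (Torus.geometry (Fin 3)) (hsDiameter σ N) (Φ.flow t z) t p.1 p.2)| ≤ L * (window τ N * V) := by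
  have hε := (hsDiameter_pos hσ N).le
  have hc : ‖(Torus.geometry (Fin 3)).sepVec (Φ.flow t z p.1).1 (Φ.flow t z p.2).1‖ = hsDiameter σ N :=
    (mem_contactSet.1 (mem_contactPairs.1 hp).2).2
  have hM : |φ (ofConfig (Torus.geometry (Fin 3)) (hsDiameter σ N) (Φ.flow t z) t p.1 p.2).fstPos -
      φ (ofConfig (Torus.geometry (Fin 3)) (hsDiameter σ N) (Φ.flow t z) t p.1 p.2).sndPos| ≤ L * hsDiameter σ N := by
    rw [ofConfig_fstPos, ofConfig_sndPos]
    exact (hLip _ _).trans_eq (by rw [hc])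
  calc |payload φ r _| ≤ L * hsDiameter σ N * impulse (ofConfig (Torus.geometry (Fin 3)) (hsDiameter σ N) (Φ.flow t z) t p.1 p.2) :=
        abs_payload_le_impulse φ (mul_nonneg hL hε) _ hM r
    _ ≤ L * hsDiameter σ N * (τ / σ * V) :=
        mul_le_mul_of_nonneg_left (impulse_le_of_flagA Φ hz hσ hτ ht hp hA) (mul_nonneg hL hε)
    _ = L * (window τ N * V) := by rw [← hsDiameter_mul_div σ τ hσ.ne' N]; ring

/-- One ordered record of a coin contributes at most `w L V / 2` to the mark. -/
theorem abs_coinTerm_le (φ : T3 → ℝ) {L : ℝ} (hL : 0 ≤ L)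
    (hLip : ∀ x y : T3, |φ x - φ y| ≤ L * ‖(Torus.geometry (Fin 3)).sepVec x y‖)
    (hz : z ∈ Φ.good) (hσ : 0 < σ) (hτ : 0 < τ) (hV : 0 ≤ V) {t : ℝ} (ht : 0 < t)
    {p : Fin (N + 1) × Fin (N + 1)} (hp : p ∈ contactPairs (Torus.geometry (Fin 3)) (hsDiameter σ N) (Φ.flow t z))
    (r : Option (Fin 3)) :
    |flagA σ τ V Φ t p.1 z * flagA σ τ V Φ t p.2 z *
        payload φ r (ofConfig (Torus.geometry (Fin 3)) (hsDiameter σ N) (Φ.flow t z) t p.1 p.2) / 2| ≤ window τ N * L * V / 2 := by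
  have hw := (window_pos hτ N).le
  have h0 : 0 ≤ window τ N * L * V / 2 := div_nonneg (mul_nonneg (mul_nonneg hw hL) hV) zero_le_two
  rcases flagA_eq_one_or (τ := τ) (V := V) (z := z) Φ t p.1 with h1 | h1
  · rcases flagA_eq_one_or (τ := τ) (V := V) (z := z) Φ t p.2 with h2 | h2
    · rw [h1, h2, one_mul, one_mul, abs_div, abs_two]
      refine div_le_div_of_nonneg_right ?_ zero_le_two
      calc _ ≤ L * (window τ N * V) := abs_payload_le_window Φ φ hL hLip hz hσ hτ ht hp h1 r
        _ = window τ N * L * V := by ring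
    · rw [h2, mul_zero, zero_mul, zero_div, abs_zero]
      exact h0
  · rw [h1, zero_mul, zero_mul, zero_div, abs_zero]
    exact h0

/-- **(b)** Every coin mark is bounded by `w L V`. -/
theorem abs_coinMark_le_window (φ : T3 → ℝ) {L : ℝ} (hL : 0 ≤ L)
    (hLip : ∀ x y : T3, |φ x - φ y| ≤ L * ‖(Torus.geometry (Fin 3)).sepVec x y‖)
    (hσ : 0 < σ) (hτ : 0 < τ) (hV : 0 ≤ V) (r : Option (Fin 3)) (n : ℕ) :
    |coinMark σ τ V φ Φ r n z| ≤ window τ N * L * V := by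
  have hw := (window_pos hτ N).le
  unfold coinMark
  split_ifs with h
  · obtain ⟨hz, hn⟩ := h
    obtain ⟨-, ht0, -⟩ := coinTime_mem Φ hz hn
    refine (Finset.abs_sum_le_sum_abs _ _).trans ?_
    refine (Finset.sum_le_card_nsmul _ _ (window τ N * L * V / 2) fun p hp =>
      abs_coinTerm_le Φ φ hL hLip hz hσ hτ hV ht0 hp r).trans ?_
    rw [nsmul_eq_mul]
    calc ((contactPairs (Torus.geometry (Fin 3)) (hsDiameter σ N) (Φ.flow (coinTime Φ z n) z)).card : ℝ) * (window τ N * L * V / 2)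
        ≤ 2 * (window τ N * L * V / 2) :=
          mul_le_mul_of_nonneg_right (by exact_mod_cast card_contactPairs_le_two Φ hz _)
            (div_nonneg (mul_nonneg (mul_nonneg hw hL) hV) zero_le_two)
      _ = window τ N * L * V := by ring
  · rw [abs_zero]
    exact mul_nonneg (mul_nonneg hw hL) hV

/-- One ordered record of a coin: its adapted-clamped payload is dominated by `L ×` its truncated predictable
range. -/
theorem abs_coinTerm_le_range (φ : T3 → ℝ) {L : ℝ} (hL : 0 ≤ L)
    (hLip : ∀ x y : T3, |φ x - φ y| ≤ L * ‖(Torus.geometry (Fin 3)).sepVec x y‖)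
    (hz : z ∈ Φ.good) (hσ : 0 < σ) (hτ : 0 < τ) (hV : 0 ≤ V) {t : ℝ} (ht : 0 < t)
    {p : Fin (N + 1) × Fin (N + 1)} (hp : p ∈ contactPairs (Torus.geometry (Fin 3)) (hsDiameter σ N) (Φ.flow t z))
    (r : Option (Fin 3)) :
    |flagA σ τ V Φ t p.1 z * flagA σ τ V Φ t p.2 z *
        payload φ r (ofConfig (Torus.geometry (Fin 3)) (hsDiameter σ N) (Φ.flow t z) t p.1 p.2) / 2| ≤
      L * (flagP σ τ V Φ t p.1 z * flagP σ τ V Φ t p.2 z *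
        min (rangeBase σ N r (ofConfig (Torus.geometry (Fin 3)) (hsDiameter σ N) (Φ.flow t z) t p.1 p.2)) (window τ N * V) / 2) := by
  have hε := (hsDiameter_pos hσ N).le
  have hw := (window_pos hτ N).le
  have hστ := (div_pos hσ hτ).le
  have hP1 : flagA σ τ V Φ t p.1 z ≤ flagP σ τ V Φ t p.1 z := flagA_le_flagP Φ hz hστ t p.1
  have hP2 : flagA σ τ V Φ t p.2 z ≤ flagP σ τ V Φ t p.2 z := flagA_le_flagP Φ hz hστ t p.2
  have hq1 := flagP_eq_one_or (τ := τ) (V := V) (z := z) Φ t p.1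
  have hq2 := flagP_eq_one_or (τ := τ) (V := V) (z := z) Φ t p.2
  have hrb := rangeBase_nonneg hε r (ofConfig (Torus.geometry (Fin 3)) (hsDiameter σ N) (Φ.flow t z) t p.1 p.2)
  have hR : 0 ≤ L * (flagP σ τ V Φ t p.1 z * flagP σ τ V Φ t p.2 z *
      min (rangeBase σ N r (ofConfig (Torus.geometry (Fin 3)) (hsDiameter σ N) (Φ.flow t z) t p.1 p.2)) (window τ N * V) / 2) :=
    mul_nonneg hL (div_nonneg (mul_nonneg (mul_nonneg (mem_Icc_of_eq_one_or hq1).1 (mem_Icc_of_eq_one_or hq2).1)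
      (le_min hrb (mul_nonneg hw hV))) zero_le_two)
  rcases flagA_eq_one_or (τ := τ) (V := V) (z := z) Φ t p.1 with h1 | h1
  · rcases flagA_eq_one_or (τ := τ) (V := V) (z := z) Φ t p.2 with h2 | h2
    · have hq1' : flagP σ τ V Φ t p.1 z = 1 := by
        rcases hq1 with h | h
        · exact h
        · rw [h1, h] at hP1; exact absurd hP1 (by norm_num)
      have hq2' : flagP σ τ V Φ t p.2 z = 1 := by
        rcases hq2 with h | h
        · exact h
        · rw [h2, h] at hP2; exact absurd hP2 (by norm_num)
      rw [h1, h2, hq1', hq2', one_mul, one_mul, one_mul, abs_div, abs_two, ← mul_div_assoc]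
      refine div_le_div_of_nonneg_right ?_ zero_le_two
      rw [mul_min_of_nonneg _ _ hL]
      refine le_min ?_ (abs_payload_le_window Φ φ hL hLip hz hσ hτ ht hp h1 r)
      have hc : ‖(Torus.geometry (Fin 3)).sepVec (Φ.flow t z p.1).1 (Φ.flow t z p.2).1‖ = hsDiameter σ N :=
        (mem_contactSet.1 (mem_contactPairs.1 hp).2).2
      exact abs_payload_le_rangeBase φ hL σ hε (Torus.geometry (Fin 3)) (Φ.flow t z) t p.1 p.2
        ((hLip _ _).trans_eq (by rw [hc])) r
    · rw [h2, mul_zero, zero_mul, zero_div, abs_zero]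
      exact hR
  · rw [h1, zero_mul, zero_mul, zero_div, abs_zero]
    exact hR

/-- **(c)** Every coin mark is dominated by `L ×` the truncated predictable range of its coin. -/
theorem abs_coinMark_le_coinRange (φ : T3 → ℝ) {L : ℝ} (hL : 0 ≤ L)
    (hLip : ∀ x y : T3, |φ x - φ y| ≤ L * ‖(Torus.geometry (Fin 3)).sepVec x y‖)
    (hσ : 0 < σ) (hτ : 0 < τ) (hV : 0 ≤ V) (r : Option (Fin 3)) (n : ℕ) :
    |coinMark σ τ V φ Φ r n z| ≤ L * coinRange σ τ V Φ r n z := by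
  unfold coinMark coinRange
  split_ifs with h
  · obtain ⟨hz, hn⟩ := h
    obtain ⟨-, ht0, -⟩ := coinTime_mem Φ hz hn
    rw [Finset.mul_sum]
    exact (Finset.abs_sum_le_sum_abs _ _).trans (Finset.sum_le_sum fun p hp =>
      abs_coinTerm_le_range Φ φ hL hLip hz hσ hτ hV ht0 hp r)
  · simp

/-- **(a)** Swapping the window-global clamp for the adapted clamp costs at most `w L V` per over-budget particle:
the two clamped transfers differ only at records both of whose adapted flags are up while a participant `i`
overflows in the window; charged to `i`, the records with `fst = i` have `|payload| ≤ L ε_N · impulse` and impulses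
summing to `≤ (τ/σ) V` (running clamp), and the records with `snd = i` are the twins of those. -/
theorem abs_Xrow_sub_Xa_le (φ : T3 → ℝ) {L : ℝ} (hL : 0 ≤ L)
    (hLip : ∀ x y : T3, |φ x - φ y| ≤ L * ‖(Torus.geometry (Fin 3)).sepVec x y‖)
    (hσ : 0 < σ) (hτ : 0 < τ) (hV : 0 ≤ V) (r : Option (Fin 3)) (hz : z ∈ Φ.good) :
    |Xrow σ τ V φ Φ r z - Xa σ τ V φ Φ r z| ≤ window τ N * L * V * (overflowCount σ τ V Φ z : ℝ) := by
  have hστ : 0 ≤ σ / τ := (div_pos hσ hτ).le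
  have hε := (hsDiameter_pos hσ N).le
  have hfin : (collisionTimes (Torus.geometry (Fin 3)) (hsDiameter σ N) (fun s => Φ.flow s z) ∩ Ioc 0 (window τ N)).Finite :=
    Φ.finite_collisionTimes_inter hz Ioc_subset_Icc_self
  have hmemT : ∀ t ∈ hfin.toFinset, 0 < t ∧ t ≤ window τ N := fun t ht =>
    ((Set.Finite.mem_toFinset hfin).1 ht).2
  -- `|payload| ≤ L ε_N · impulse` at every record of the orbit (contact + Lipschitz)
  have hpay : ∀ t (p : Fin (N + 1) × Fin (N + 1)), p ∈ contactPairs (Torus.geometry (Fin 3)) (hsDiameter σ N) (Φ.flow t z) →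
      |payload φ r (ofConfig (Torus.geometry (Fin 3)) (hsDiameter σ N) (Φ.flow t z) t p.1 p.2)| ≤
        L * hsDiameter σ N * impulse (ofConfig (Torus.geometry (Fin 3)) (hsDiameter σ N) (Φ.flow t z) t p.1 p.2) := by
    intro t p hp
    have hc : ‖(Torus.geometry (Fin 3)).sepVec (Φ.flow t z p.1).1 (Φ.flow t z p.2).1‖ = hsDiameter σ N :=
      (mem_contactSet.1 (mem_contactPairs.1 hp).2).2
    refine abs_payload_le_impulse φ (mul_nonneg hL hε) _ ?_ r
    rw [ofConfig_fstPos, ofConfig_sndPos]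
    exact (hLip _ _).trans_eq (by rw [hc])
  -- the overflow indicator is the complement of the window-global clamp
  have hoI : ∀ i, (if V < runAct σ τ Φ (window τ N) i z then (1 : ℝ) else 0) = 1 - flagG σ τ V Φ i z := by
    intro i
    unfold flagG
    split_ifs with h1 h2 h2 <;>
      first | exact absurd h2 (not_le.2 h1) | exact absurd (not_lt.1 h1) h2 | norm_num
  -- Step 1: the difference, record by record
  have hdiff : Xrow σ τ V φ Φ r z - Xa σ τ V φ Φ r z =
      ∑ t ∈ hfin.toFinset, ∑ p ∈ contactPairs (Torus.geometry (Fin 3)) (hsDiameter σ N) (Φ.flow t z),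
        (flagG σ τ V Φ p.1 z * flagG σ τ V Φ p.2 z *
            payload φ r (ofConfig (Torus.geometry (Fin 3)) (hsDiameter σ N) (Φ.flow t z) t p.1 p.2) / 2 -
          flagA σ τ V Φ t p.1 z * flagA σ τ V Φ t p.2 z *
            payload φ r (ofConfig (Torus.geometry (Fin 3)) (hsDiameter σ N) (Φ.flow t z) t p.1 p.2) / 2) := by
    simp only [Xrow, Xa, HardSphereFlow.collisionSum_eq, collisionSum_eq_finset_sum hfin, ofConfig_fst,
      ofConfig_snd, ofConfig_time, ← Finset.sum_sub_distrib]
  -- Step 2: termwise, `|ω ω - ω̃ ω̃| |payload|/2 ≤ (1{fst overflows} ω̃_fst + 1{snd overflows} ω̃_snd) L ε I/2`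
  have hterm : ∀ t ∈ hfin.toFinset, ∀ p ∈ contactPairs (Torus.geometry (Fin 3)) (hsDiameter σ N) (Φ.flow t z),
      |flagG σ τ V Φ p.1 z * flagG σ τ V Φ p.2 z *
            payload φ r (ofConfig (Torus.geometry (Fin 3)) (hsDiameter σ N) (Φ.flow t z) t p.1 p.2) / 2 -
          flagA σ τ V Φ t p.1 z * flagA σ τ V Φ t p.2 z *
            payload φ r (ofConfig (Torus.geometry (Fin 3)) (hsDiameter σ N) (Φ.flow t z) t p.1 p.2) / 2| ≤
        ((if V < runAct σ τ Φ (window τ N) p.1 z then (1 : ℝ) else 0) * flagA σ τ V Φ t p.1 z +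
            (if V < runAct σ τ Φ (window τ N) p.2 z then (1 : ℝ) else 0) * flagA σ τ V Φ t p.2 z) *
          (L * hsDiameter σ N * impulse (ofConfig (Torus.geometry (Fin 3)) (hsDiameter σ N) (Φ.flow t z) t p.1 p.2) / 2) := by
    intro t ht p hp
    have htw := (hmemT t ht).2
    rw [hoI, hoI, mul_div_assoc, mul_div_assoc, ← sub_mul, abs_mul, abs_div, abs_two]
    refine mul_le_mul (abs_mul_sub_mul_le (flagG_eq_one_or Φ p.1) (flagG_eq_one_or Φ p.2)
        (flagA_eq_one_or Φ t p.1) (flagA_eq_one_or Φ t p.2) (flagG_le_flagA Φ hz hστ htw p.1)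
        (flagG_le_flagA Φ hz hστ htw p.2)) (div_le_div_of_nonneg_right (hpay t p hp) zero_le_two)
      (by positivity) (add_nonneg (mul_nonneg ?_ ?_) (mul_nonneg ?_ ?_))
    · linarith [(mem_Icc_of_eq_one_or (flagG_eq_one_or (τ := τ) (V := V) (z := z) Φ p.1)).2]
    · exact (mem_Icc_of_eq_one_or (flagA_eq_one_or (τ := τ) (V := V) (z := z) Φ t p.1)).1
    · linarith [(mem_Icc_of_eq_one_or (flagG_eq_one_or (τ := τ) (V := V) (z := z) Φ p.2)).2]
    · exact (mem_Icc_of_eq_one_or (flagA_eq_one_or (τ := τ) (V := V) (z := z) Φ t p.2)).1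
  -- Step 3: the twin symmetry `snd ↔ fst` of the charged sums at each collision time
  have htwin : ∀ t ∈ hfin.toFinset,
      ∑ p ∈ contactPairs (Torus.geometry (Fin 3)) (hsDiameter σ N) (Φ.flow t z),
        (if V < runAct σ τ Φ (window τ N) p.2 z then (1 : ℝ) else 0) * flagA σ τ V Φ t p.2 z *
          impulse (ofConfig (Torus.geometry (Fin 3)) (hsDiameter σ N) (Φ.flow t z) t p.1 p.2) =
      ∑ p ∈ contactPairs (Torus.geometry (Fin 3)) (hsDiameter σ N) (Φ.flow t z),
        (if V < runAct σ τ Φ (window τ N) p.1 z then (1 : ℝ) else 0) * flagA σ τ V Φ t p.1 z *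
          impulse (ofConfig (Torus.geometry (Fin 3)) (hsDiameter σ N) (Φ.flow t z) t p.1 p.2) := by
    intro t _
    refine Finset.sum_equiv (Equiv.prodComm _ _) (fun p => ?_) (fun p hp => ?_)
    · rw [Equiv.prodComm_apply]
      exact ⟨swap_mem_contactPairs_torus, fun h => by simpa using swap_mem_contactPairs_torus h⟩
    · rw [Equiv.prodComm_apply, Prod.fst_swap, Prod.snd_swap, impulse_twin Φ hz hp]
  -- Step 4: charge every record to its overflowing participant `i`
  have hswap : ∑ t ∈ hfin.toFinset, ∑ p ∈ contactPairs (Torus.geometry (Fin 3)) (hsDiameter σ N) (Φ.flow t z),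
        (if V < runAct σ τ Φ (window τ N) p.1 z then (1 : ℝ) else 0) * flagA σ τ V Φ t p.1 z *
          impulse (ofConfig (Torus.geometry (Fin 3)) (hsDiameter σ N) (Φ.flow t z) t p.1 p.2) =
      ∑ i, (if V < runAct σ τ Φ (window τ N) i z then (1 : ℝ) else 0) *
        ∑ t ∈ hfin.toFinset, ∑ p ∈ contactPairs (Torus.geometry (Fin 3)) (hsDiameter σ N) (Φ.flow t z),
          (if p.1 = i then flagA σ τ V Φ t i z *
            impulse (ofConfig (Torus.geometry (Fin 3)) (hsDiameter σ N) (Φ.flow t z) t p.1 p.2) else 0) := by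
    have hpt : ∀ t (p : Fin (N + 1) × Fin (N + 1)),
        (if V < runAct σ τ Φ (window τ N) p.1 z then (1 : ℝ) else 0) * flagA σ τ V Φ t p.1 z *
            impulse (ofConfig (Torus.geometry (Fin 3)) (hsDiameter σ N) (Φ.flow t z) t p.1 p.2) =
          ∑ i, (if V < runAct σ τ Φ (window τ N) i z then (1 : ℝ) else 0) *
            (if p.1 = i then flagA σ τ V Φ t i z *
              impulse (ofConfig (Torus.geometry (Fin 3)) (hsDiameter σ N) (Φ.flow t z) t p.1 p.2) else 0) := by
      intro t p
      rw [Finset.sum_eq_single p.1 (fun i _ hi => by rw [if_neg (Ne.symm hi), mul_zero])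
        (fun h => absurd (Finset.mem_univ _) h), if_pos rfl, mul_assoc]
    simp_rw [hpt]
    rw [Finset.sum_congr rfl fun t _ => Finset.sum_comm, Finset.sum_comm]
    simp_rw [Finset.mul_sum]
  -- Step 5: the running clamp bounds the charged impulses of each particle by `(τ/σ) V`
  have hiff : ∀ S : ℝ, σ / τ * S ≤ V → S ≤ τ / σ * V := fun S h =>
    calc S = τ / σ * (σ / τ * S) := by field_simp
      _ ≤ τ / σ * V := mul_le_mul_of_nonneg_left h (by positivity)
  have hB : ∀ i, ∑ t ∈ hfin.toFinset, ∑ p ∈ contactPairs (Torus.geometry (Fin 3)) (hsDiameter σ N) (Φ.flow t z),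
      (if p.1 = i then flagA σ τ V Φ t i z *
        impulse (ofConfig (Torus.geometry (Fin 3)) (hsDiameter σ N) (Φ.flow t z) t p.1 p.2) else 0) ≤ τ / σ * V := by
    intro i
    -- running activity of `i` as a running sum over the collision times of the window
    have hrun : ∀ t, t ≤ window τ N → runAct σ τ Φ t i z = σ / τ *
        ∑ s ∈ hfin.toFinset.filter (· ≤ t), ∑ p ∈ contactPairs (Torus.geometry (Fin 3)) (hsDiameter σ N) (Φ.flow s z),
          (if p.1 = i then impulse (ofConfig (Torus.geometry (Fin 3)) (hsDiameter σ N) (Φ.flow s z) s p.1 p.2) else 0) := by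
      intro t htw
      have hfin' : (collisionTimes (Torus.geometry (Fin 3)) (hsDiameter σ N) (fun s => Φ.flow s z) ∩ Ioc 0 t).Finite :=
        Φ.finite_collisionTimes_inter hz Ioc_subset_Icc_self
      have hTf : hfin'.toFinset = hfin.toFinset.filter (· ≤ t) := by
        ext s
        simp only [Set.Finite.mem_toFinset, Finset.mem_filter, Set.mem_inter_iff, Set.mem_Ioc]
        constructor
        · rintro ⟨hs, hs0, hst⟩
          exact ⟨⟨hs, hs0, hst.trans htw⟩, hst⟩
        · rintro ⟨⟨hs, hs0, -⟩, hst⟩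
          exact ⟨hs, hs0, hst⟩
      unfold runAct
      rw [HardSphereFlow.collisionSum_eq, collisionSum_eq_finset_sum hfin', hTf]
      simp only [ofConfig_fst]
    calc ∑ t ∈ hfin.toFinset, ∑ p ∈ contactPairs (Torus.geometry (Fin 3)) (hsDiameter σ N) (Φ.flow t z),
          (if p.1 = i then flagA σ τ V Φ t i z *
            impulse (ofConfig (Torus.geometry (Fin 3)) (hsDiameter σ N) (Φ.flow t z) t p.1 p.2) else 0)
        = ∑ t ∈ hfin.toFinset, flagA σ τ V Φ t i z *
            ∑ p ∈ contactPairs (Torus.geometry (Fin 3)) (hsDiameter σ N) (Φ.flow t z),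
              (if p.1 = i then impulse (ofConfig (Torus.geometry (Fin 3)) (hsDiameter σ N) (Φ.flow t z) t p.1 p.2) else 0) :=
          Finset.sum_congr rfl fun t _ => by
            rw [Finset.mul_sum]
            exact Finset.sum_congr rfl fun p _ => by rw [mul_ite, mul_zero]
      _ ≤ τ / σ * V :=
          sum_indicator_running_le _ _ _ (fun t _ => Finset.sum_nonneg fun p _ => ite_impulse_nonneg _ _)
            (fun t _ => flagA_eq_one_or (τ := τ) (V := V) (z := z) Φ t i) (fun t ht h1 => ?_)
            (by positivity)
    have hle : runAct σ τ Φ t i z ≤ V := by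
      by_contra h
      simp [flagA, h] at h1
    rw [hrun t (hmemT t ht).2] at hle
    exact hiff _ hle
  -- Step 6: the overflow count
  have hK : (overflowCount σ τ V Φ z : ℝ) = ∑ i, (if V < runAct σ τ Φ (window τ N) i z then (1 : ℝ) else 0) := by
    unfold overflowCount
    rw [Finset.natCast_card_filter]
  -- assembly
  rw [hdiff]
  calc |∑ t ∈ hfin.toFinset, ∑ p ∈ contactPairs (Torus.geometry (Fin 3)) (hsDiameter σ N) (Φ.flow t z),
          (flagG σ τ V Φ p.1 z * flagG σ τ V Φ p.2 z *
              payload φ r (ofConfig (Torus.geometry (Fin 3)) (hsDiameter σ N) (Φ.flow t z) t p.1 p.2) / 2 -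
            flagA σ τ V Φ t p.1 z * flagA σ τ V Φ t p.2 z *
              payload φ r (ofConfig (Torus.geometry (Fin 3)) (hsDiameter σ N) (Φ.flow t z) t p.1 p.2) / 2)|
      ≤ ∑ t ∈ hfin.toFinset, ∑ p ∈ contactPairs (Torus.geometry (Fin 3)) (hsDiameter σ N) (Φ.flow t z),
          ((if V < runAct σ τ Φ (window τ N) p.1 z then (1 : ℝ) else 0) * flagA σ τ V Φ t p.1 z +
              (if V < runAct σ τ Φ (window τ N) p.2 z then (1 : ℝ) else 0) * flagA σ τ V Φ t p.2 z) *
            (L * hsDiameter σ N * impulse (ofConfig (Torus.geometry (Fin 3)) (hsDiameter σ N) (Φ.flow t z) t p.1 p.2) / 2) :=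
        (Finset.abs_sum_le_sum_abs _ _).trans (Finset.sum_le_sum fun t ht =>
          (Finset.abs_sum_le_sum_abs _ _).trans (Finset.sum_le_sum fun p hp => hterm t ht p hp))
    _ = L * hsDiameter σ N / 2 *
          ((∑ t ∈ hfin.toFinset, ∑ p ∈ contactPairs (Torus.geometry (Fin 3)) (hsDiameter σ N) (Φ.flow t z),
              (if V < runAct σ τ Φ (window τ N) p.1 z then (1 : ℝ) else 0) * flagA σ τ V Φ t p.1 z *
                impulse (ofConfig (Torus.geometry (Fin 3)) (hsDiameter σ N) (Φ.flow t z) t p.1 p.2)) +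
            ∑ t ∈ hfin.toFinset, ∑ p ∈ contactPairs (Torus.geometry (Fin 3)) (hsDiameter σ N) (Φ.flow t z),
              (if V < runAct σ τ Φ (window τ N) p.2 z then (1 : ℝ) else 0) * flagA σ τ V Φ t p.2 z *
                impulse (ofConfig (Torus.geometry (Fin 3)) (hsDiameter σ N) (Φ.flow t z) t p.1 p.2)) := by
        rw [← Finset.sum_add_distrib, Finset.mul_sum]
        refine Finset.sum_congr rfl fun t _ => ?_
        rw [← Finset.sum_add_distrib, Finset.mul_sum]
        refine Finset.sum_congr rfl fun p _ => ?_
        ring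
    _ = L * hsDiameter σ N *
          ∑ t ∈ hfin.toFinset, ∑ p ∈ contactPairs (Torus.geometry (Fin 3)) (hsDiameter σ N) (Φ.flow t z),
            (if V < runAct σ τ Φ (window τ N) p.1 z then (1 : ℝ) else 0) * flagA σ τ V Φ t p.1 z *
              impulse (ofConfig (Torus.geometry (Fin 3)) (hsDiameter σ N) (Φ.flow t z) t p.1 p.2) := by
        rw [Finset.sum_congr rfl htwin]
        ring
    _ = L * hsDiameter σ N * ∑ i, (if V < runAct σ τ Φ (window τ N) i z then (1 : ℝ) else 0) *
          ∑ t ∈ hfin.toFinset, ∑ p ∈ contactPairs (Torus.geometry (Fin 3)) (hsDiameter σ N) (Φ.flow t z),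
            (if p.1 = i then flagA σ τ V Φ t i z *
              impulse (ofConfig (Torus.geometry (Fin 3)) (hsDiameter σ N) (Φ.flow t z) t p.1 p.2) else 0) := by
        rw [hswap]
    _ ≤ L * hsDiameter σ N * ∑ i, (if V < runAct σ τ Φ (window τ N) i z then (1 : ℝ) else 0) *
          (τ / σ * V) :=
        mul_le_mul_of_nonneg_left (Finset.sum_le_sum fun i _ =>
          mul_le_mul_of_nonneg_left (hB i) (by positivity)) (mul_nonneg hL hε)
    _ = L * hsDiameter σ N * (τ / σ * V) * (overflowCount σ τ V Φ z : ℝ) := by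
        rw [← Finset.sum_mul, ← hK]
        ring
    _ = window τ N * L * V * (overflowCount σ τ V Φ z : ℝ) := by
        rw [← hsDiameter_mul_div σ τ hσ.ne' N]
        ring

/-- **Adapted-clamp kinematics at EVERY diameter** (the statement of the stub without the regularity hypothesis
`σ < 1/2`): for smooth `φ` there is `L > 0` such that for all `σ, τ > 0`, `V ≥ 0`, every `N`, every hard-sphere flow and
every row, (a) `|X - X̃| ≤ w L V · overflowCount` on good orbits, (b) `|T_n| ≤ w L V`, (c) `|T_n| ≤ L ρ_n`. -/
theorem adaptedClampKinematics :
    ∀ φ : T3 → ℝ, Torus.IsSmooth φ → ∃ L : ℝ, 0 < L ∧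
      ∀ (σ τ V : ℝ), 0 < σ → 0 < τ → 0 ≤ V → ∀ (N : ℕ) (Φ : Flow σ N) (r : Option (Fin 3)),
        (∀ z ∈ Φ.good, |Xrow σ τ V φ Φ r z - Xa σ τ V φ Φ r z| ≤
          window τ N * L * V * (overflowCount σ τ V Φ z : ℝ)) ∧
        (∀ (n : ℕ) (z : Phase N), |coinMark σ τ V φ Φ r n z| ≤ window τ N * L * V) ∧
        (∀ (n : ℕ) (z : Phase N), |coinMark σ τ V φ Φ r n z| ≤ L * coinRange σ τ V Φ r n z) := by
  intro φ hφ
  obtain ⟨L, hL, hLip⟩ := exists_lipschitz φ hφ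
  refine ⟨L, hL, fun σ τ V hσ hτ hV N Φ r => ⟨fun z hz => ?_, fun n z => ?_, fun n z => ?_⟩⟩
  · exact abs_Xrow_sub_Xa_le Φ φ hL.le hLip hσ hτ hV r hz
  · exact abs_coinMark_le_window Φ φ hL.le hLip hσ hτ hV r n
  · exact abs_coinMark_le_coinRange Φ φ hL.le hLip hσ hτ hV r n

end Orbit

end AdaptedClampKinematics

/-- **S2 · adapted-clamp kinematics (registered stub of line `coarse-coin-entropy-chain`, crux
`EquilibriumClampedCollisionalWindowLD`).** For smooth `φ` there is `L > 0` (a Lipschitz constant of `φ` for the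
minimal-image separation) such that for all `0 < σ < 1/2`, `τ > 0`, `V ≥ 0`, every `N`, every hard-sphere flow and every
row: (a) on good orbits the window-global and the adapted clamped transfers differ by at most `w L V ·` (number of
over-budget particles); (b) every coin mark is bounded by `w L V`; (c) every coin mark is dominated by `L ×` its
truncated predictable range. Pathwise; the hypothesis `σ < 1/2` of the registered signature is NOT used
(`AdaptedClampKinematics.adaptedClampKinematics` is the same statement at every diameter). -/
theorem stub_adaptedClampKinematics :
    ∀ φ : T3 → ℝ, Torus.IsSmooth φ → ∃ L : ℝ, 0 < L ∧
      ∀ (σ τ V : ℝ), 0 < σ → σ < 1 / 2 → 0 < τ → 0 ≤ V → ∀ (N : ℕ) (Φ : Flow σ N) (r : Option (Fin 3)),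
        (∀ z ∈ Φ.good, |Xrow σ τ V φ Φ r z - Xa σ τ V φ Φ r z| ≤
          window τ N * L * V * (overflowCount σ τ V Φ z : ℝ)) ∧
        (∀ (n : ℕ) (z : Phase N), |coinMark σ τ V φ Φ r n z| ≤ window τ N * L * V) ∧
        (∀ (n : ℕ) (z : Phase N), |coinMark σ τ V φ Φ r n z| ≤ L * coinRange σ τ V Φ r n z) := by
  intro φ hφ
  obtain ⟨L, hL, h⟩ := AdaptedClampKinematics.adaptedClampKinematics φ hφ
  exact ⟨L, hL, fun σ τ V hσ _ hτ hV => h σ τ V hσ hτ hV⟩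

end Summit.AtomisticToContinuum.HydrodynamicLimit.Theorems.ClampedTransferCoin

end
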